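import Mathlib
import Literature.MathematicalPhysics.QuantumFieldTheory.Balaban1983to89.B13Resummation
import Literature.MathematicalPhysics.QuantumFieldTheory.Balaban1983to89.B16
import Literature.MathematicalPhysics.QuantumFieldTheory.Balaban1983to89.B14RelAnimalBound

/-!
# `Balaban1983to89.B16Exp198` — the exponentiation (1.90), (1.97) ⇒ (1.98)–(1.99) of T. Bałaban, *Large field
renormalization. II. Localization, exponentiation, and bounds for the 𝐑 operation*, Commun. Math. Phys. **122**, 355–392
(1989) [Balaban1989LargeFieldII] (cell paper B16; PDF held `paper:balaban1989-cmp122-large-field-ii`, journal page = PDF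
page + 354), pp. 387–391 [PDF 33–37]: the printed *"given by the convergent series (7.13) [I] (with proper notational
changes)"* MADE PRECISE AND PROVED from the Kotecký–Preiss theorem proved in the tree — a KERNEL CERTIFICATE for the located
gap GAPS.md G-B16-09 of the audit cell `pub-balaban` (*"proof by reference twice removed; the polymer system is never written
down"*), and the kernel form of the necessary condition behind GAPS.md G-B16-11 (the second exponentiation (1.103) → (1.104)).

HEADER (lean-in-tree rule 2026-08-18).  The Bałaban papers are manuscripts UNDER ADJUDICATION: nothing printed in them is
asserted here.  The displayed bounds (1.97) (input) and (1.99) (output) are unit b02's quoted leaves `B16.Ineq197`,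
`B16.Ineq199` of the tree module `…Balaban1983to89.B16` (imported, not modified); the combinatorial engine is R. Kotecký,
D. Preiss, *Cluster expansion for abstract polymer models*, Commun. Math. Phys. **103** (1986) 491–498 [KoteckyPreiss1986],
Theorem p. 492 with its estimate (4), PROVED sorry-free in `Literature.Probability.LatticeModels.ClusterExpansionKPBound`
(`koteckyPreiss_truncatedWeight_bound_holds`; used: `sum_norm_truncatedWeight_le_exp_neg_mul`, `kp_hypothesis_of_fintype`,
`isKPVolume_of_tsum_le`, `polymerLogZ_eq_sum_truncatedWeight`, `exp_polymerLogZ_of_kp`, `truncatedWeight_eq_zero_of_kp`).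
The pattern is unit pv18's `…Balaban1983to89.B13Resummation` (the [26]-step (2.38) ⇒ (2.41) of [II] = B13, *"(7.13) [I]"* =
(2.13) of [II], cell DIVERGENCE D-T1b), whose Parts A–D are repeated here WITH THE NOTATIONAL CHANGE the paper announces and
never writes: the fixed class-2 large-field components Y₁, …, Y_m are excluded from compatibility, entropy and volume but
kept in the localization.  Unit b01's `…B14RelAnimalBound` (the relative anchored tree-graph bound, Dimock's Lemma E.3) is
imported for the shape bridges of Part F only.  NEW sibling module of unit `b2b-balaban-b02` (gen 4); no existing module is
modified.  Every `theorem` is finite combinatorics or real arithmetic, proved without `sorry` and without new axioms.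

## What is printed (verbatim from the page renders `…large-field-II-p033…p037-x2.png`)

p. 387 [33] bottom – p. 388 [34] top: *"The next step is a construction of an exponentiated cluster expansion for the
expression in the curly bracket in (1.72). The first operation is the Mayer expansion of the exponential, the same as in
(7.1) [I]. We obtain a sum of terms over {X₁,…,X_n} and subfamilies 𝐃 ⊂ 𝐃_k. Each term determines the localization domain
X′₀ = ⋃_{Y∈𝐃} Y ∪ ⋃_{j=1}^n X_j. This domain is decomposed into components, but now we define them in a different way. At
first we take components of X′₀∖⋃_{i=1}^m Y_i, and we consider two such components as connected, if they are contained in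
one localization domain Y of a term in the product. This means that each component has a correct tree graph decay factor,
controlling summations over components. Thus we write X′₀ = ⋃_{p=1}^r X′_p, and the expression corresponding to X′₀
factorizes in the components. For the fixed decomposition we resum all the expressions determining the same components. We
obtain the following polymer expansion {⋯} = 1 + Σ_{r≥1} Σ_{{X′₁,…,X′_r}} Π_{p=1}^r F(X′_p), (1.90) where the activities
F(X′) are defined by (1.91) … Here the summation is over {X_{j₁},…,X_{j_q}} and 𝐃 such that the connected localization
domain they determine is equal to X′. To get a convergent exponentiated expansion of the right-hand side of (1.90), we have
to obtain the bounds for the activities."*; p. 388 (after (1.93)): *"where we have used the fact that α is sufficiently small, e.g.,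
α^{1/3} ≤ exp(−(1+β)κ2d), to produce the exponential factors connecting graphs in domains Y, in the cases they intersect
outside Z′"*; p. 389 [35]: *"Either the domain X′ contains one of the domains Y_i, … or the domain X′ is disjoint with
⋃_{i=1}^m Y_i"*; (1.97) p. 389–390: *"|F(X′)| ≤ c₁ exp(−(1+β)κ d_{k,∪Y_i}(X′)), (1.97) where c₁ = exp(−p₀(g_k)) if X′ does
not intersect ⋃_{i=1}^m Y_i, and c₁ = α^{1/3} in the remaining cases. The estimate (1.97) is sufficient for convergence of
the exponentiated cluster expansion, and we have {⋯} = exp 𝐑′^{(k)} = exp Σ_X 𝐑′^{(k)}(X). (1.98) … It is given by the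
convergent series (7.13) [I] (with proper notational changes), and it satisfies the inequality
|𝐑′^{(k)}(X,(𝐔,𝐉))| ≤ O(1)c₁ exp(−(1+½β)κ d_{k,∪Y_i}(X)). (1.99)"*; (1.67) p. 376 [22]: *"d_{k,Z}(Y) = M⁻¹ (the length of a
shortest tree graph contained in Y and intersecting all M-cubes of the components of Y∖Z)"*; p. 391 [37] (the second
expansion): *"Also, we use the ordinary notion of connectedness to define components. … This bound is enough for the
convergence of the exponentiated cluster expansion. This requires a comment, because in this bound there are no tree decay
exponential factors for the domains Y_i. In fact, looking carefully at a standard proof of the convergence of the expansion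
(e.g., in [26]), we see that in the present situation such factors are not needed, because there are no summations over
these domains, they are fixed."*

## The notational change, typed (Parts A–D; cell DIVERGENCE D-b02.14)

Over an ABSTRACT finite catalogue as in `B13Resummation`: a finite type `Dom` (the localization domains 𝐃_k restricted to the
torus), a sub-catalogue `Λ : Finset Dom` (the polymers X′ of (1.90)), TWO footprint maps — `cubes : Dom → Finset Cube` (ALL
M-cubes of X′: localization, the union condition of (1.99)) and `out : Dom → Finset Cube` (the M-cubes of X′∖⋃_i Y_i:
incompatibility, the Kotecký–Preiss size a(X′) = τ·#out X′, the anchors) — a size `d : Dom → ℝ` (the relative d_{k,∪Y_i} of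
(1.67)), an incompatibility `ι` (p. 388 ll. 1–3: two polymers are incompatible iff their parts OUTSIDE ⋃_i Y_i meet; polymers
attached to the same FIXED Y_i are compatible — 𝐓′_k(Y_i) stands outside the curly bracket of (1.72)) which is footprint-local
through `reach` INTO `out` (`ι Z′ Z` forces Z′ to own an outside cube of `reach Z`, `#reach Z ≤ ν·#out Z`).  The three
geometric inputs become the RELATIVE leaves: (1.26)_rel `Ineq126 Λ out d κ₀ K₀` (the anchored sum at an OUTSIDE cube — at a
cube of Y_i it is unbounded: X′ = Y_i ∪ {one collar cube} has d_{k,∪Y_i}(X′) = 0; = [Dimock2013BalabanII] Lemma E.3, unit b01's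
`B14.RelAnimal.sumsum`, Part F), the volume bound `VolBound Λ out d c₁` ((1.67) charges every met outside cube; print extracts exactly
this outside volume in (1.93): the factor exp(−(3·2^d)⁻¹βκM^{−d}|X′∖∪Y_i|)), and the
subadditivity `RelSubadd` of the relative size over ι-CLUSTERS covering X (joining the trees of two incompatible polymers
inside the outside cube where they meet costs `c`; print: *"α^{1/3} ≤ exp(−(1+β)κ2d), to produce the exponential factors
connecting graphs in domains Y, in the cases they intersect outside Z′"*, c = 2d) — NOT over all covering families: for two
polymers glued only through a fixed Y_i it is false (two collar cubes on opposite sides of Y_i), and such families are not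
clusters, on which the truncated functional vanishes (`truncatedWeight_eq_zero_of_kp`).  𝐑′^{(k)}(X) := `locR` = the part of
log Ξ localized, by the FULL footprints, in X.  PROVED: `logZ_eq_sum_locR` (log Ξ = Σ_X 𝐑′(X)), `kp_condition_rel` ([KP86] (1)
with a = τ·#out), `exp_sum_locR_eq_Z` ((1.98): exp Σ_X 𝐑′(X) = {⋯}), `norm_locR_le` / `norm_locR_le_of_small` ((1.99) with
its O(1) = e ν c₁ K₀² and the two explicit inequalities "κ large" r₁ + 2κ₀ + 2 ≤ R, "activity small" A e^{b+1} K₀ ν c₁ ≤ 1,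
b = r₁c the merging cost; the lost rate (1+β)κ → (1+½β)κ of print is ½βκ ≥ 2κ₀ + 2).

## The edge to `B16.lean` (Part E) and the shape bridges (Part F)

`Geometry S Cube` over unit b02's `B16.RelDomainSys` (domains with `dRel` = d_{k,∪Y_i} and the c₁-selector `MeetsLF X` =
"X ∩ ⋃_i Y_i ≠ ∅") bundles the polymer sub-catalogue `adm`, the cubes, the fixed cubes `Yfix` (⋃_i Y_i), `ι`, `reach` and the
three relative leaves with their constants; `ineq199_of_ineq197`: **`B16.Ineq197` ⇒ `B16.Ineq199`** for
𝐑′^{(k)}(X, φ) := `locR` of the activities Z ↦ F(Z, φ), with O(1) = e ν c₁ K₀², under the space-restriction property, the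
selector smallness e^{−p₀(g_k)} ≤ α^{1/3} (g_k small; cell GAPS G-pv13-3 (c)), "κ large" ½βκ ≥ 2κ₀ + 2 and "α small"
α^{1/3} e^{(1+½β)κc + 1} K₀ ν c₁ ≤ 1 (cell SMALLNESS.md); `eq198_of_ineq197`: (1.98) at every configuration in all the spaces.
Part F: `Ineq126 adm small dRel` and `VolBound adm small dRel` FROM unit b01's `B14.RelAnimal.RelCubeSystem` (`sumsum`,
`RelAnimalLeaf`) — shape conversions only (b01's carrier is [III] §2's resummed class; the instance for B16's ⋃_i Y_i is the
joiner's, cell TEMPLATE.md §15).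

## Part N — the second exponentiation (p. 391; cell GAPS G-B16-11 (ii), G-adv3-4)

Under *"the ordinary notion of connectedness"* all polymers containing a fixed Y_i are PAIRWISE INCOMPATIBLE.  PROVED, for any
polymer system: if the Kotecký–Preiss condition holds on a volume containing N pairwise incompatible polymers of activity
≥ ε in modulus then N·ε ≤ e⁻¹ (`card_mul_le_exp_neg_one_of_isKPVolume`: no size function helps — *"there are no summations
over these domains, they are fixed"* removes the entropy of Y_i, not the sum over what is attached to it); the partition
function of such a clique is 1 + Σ w (`polymerPartitionFunction_clique`) and VANISHES for the admissible activity pattern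
w ≡ −1/N (`polymerPartitionFunction_clique_eq_zero`), so no exponential representation of the square bracket of (1.103)
follows from activity bounds that are uniform in N (`not_exists_exp_eq_clique`).  This is the kernel form of an objection to
the printed JUSTIFICATION, not a disproof of (1.104) (cell GAPS G-B16-11 (v)); Theorem 1 / Cor. 3 use the FIRST expansion only.

NOT TYPED HERE: the Mayer step (1.90)–(1.91) and the activity estimates (1.92)–(1.97) (quoted leaf `B16.Ineq197`); the
construction of the instance of `Geometry` from the lattice (joiner); [III]'s consumption of (1.99) (unit b01, GAPS G-B16-10).
Value = kernel certificate of a located proof-by-reference + precise negative lemma, NOT summit progress.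
-/

open Finset

noncomputable section

namespace Literature.MathematicalPhysics.QuantumFieldTheory.Balaban1983to89.B16Exp198

open Literature.Probability.LatticeModels
open Literature.MathematicalPhysics.QuantumFieldTheory.Balaban1983to89.B13FamilySum

variable {Dom Cube : Type*} [DecidableEq Dom] [DecidableEq Cube]
variable (ι : Dom → Dom → Prop) [DecidableRel ι]

/-! ## Part A. The polymer system of (1.90) with two footprints; 𝐑′^{(k)}(X) as the X-localized part of log Ξ -/

/-- **𝐑′^{(k)}(X)** of (1.98)–(1.99) p. 390 [36], verbatim: *"{⋯} = exp 𝐑′^{(k)} = exp Σ_X 𝐑′^{(k)}(X). (1.98) The summation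
here is over domains X ∈ 𝐃_k … It is given by the convergent series (7.13) [I] (with proper notational changes)"* — in the
Kotecký–Preiss form of that series ([KP86, (2)–(3)]: log Ξ = Σ_C Φ^T(C), tree `truncatedWeight`): the sum of the truncated
functionals over the finite families `C ⊆ Λ` of polymers of (1.90) whose union of FULL footprints is exactly `X`
(`B13FamilySum.coveringFamilies Λ cubes X`; = `B13Resummation.locE` with the polymer sub-catalogue `Λ` in place of `univ`).
[cite: Balaban1989LargeFieldII, (1.98)-(1.99) p.390] -/
def locR (Λ : Finset Dom) (cubes : Dom → Finset Cube) (w : Dom → ℂ) (X : Finset Cube) : ℂ :=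
  ∑ C ∈ coveringFamilies Λ cubes X, truncatedWeight ι w C

/-- 𝐑′^{(k)}(X) depends only on the activities of the polymers of `Λ` lying inside `X` (p. 390: *"The expression 𝐑′^{(k)}(X)
depends on the background field U_k restricted to X"*). [cite: Balaban1989LargeFieldII, p.390 (after (1.98))] -/
theorem locR_congr {Λ : Finset Dom} {cubes : Dom → Finset Cube} {w w' : Dom → ℂ} {X : Finset Cube}
    (h : ∀ Z ∈ Λ, cubes Z ⊆ X → w Z = w' Z) : locR ι Λ cubes w X = locR ι Λ cubes w' X := by
  refine Finset.sum_congr rfl fun C hC => truncatedWeight_congr fun Z hZ => h Z ((mem_coveringFamilies.1 hC).1 hZ) ?_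
  rw [← (mem_coveringFamilies.1 hC).2]
  exact Finset.subset_biUnion_of_mem cubes hZ

/-- (1.98), the localization: log Ξ_Λ = Σ_C Φ^T(C) = Σ_X 𝐑′^{(k)}(X), the outer sum over the finitely many unions X of FULL
footprints of families of polymers ([KP86, (2)] = tree `polymerLogZ_eq_sum_truncatedWeight`, regrouped by the union).
[cite: Balaban1989LargeFieldII, (1.98) p.390] -/
theorem logZ_eq_sum_locR (Λ : Finset Dom) (cubes : Dom → Finset Cube) (w : Dom → ℂ) :
    polymerLogZ ι w Λ = ∑ X ∈ Λ.powerset.image (fun C => C.biUnion cubes), locR ι Λ cubes w X := by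
  rw [polymerLogZ_eq_sum_truncatedWeight]
  unfold locR coveringFamilies
  exact (Finset.sum_fiberwise_of_maps_to (fun C hC => Finset.mem_image_of_mem _ hC) _).symm

/-- **Relative subadditivity of the size over incompatibility clusters** (the relative form of (2.27) [II] / of the joining
step in (1.93)): for every ι-CLUSTER `C ⊆ Λ` of polymers whose full footprints cover `X`,
`d(X) + c ≤ Σ_{Z∈C} (d(Z) + c)`.  In the intended model (d = d_{k,∪Y_i} of (1.67), ι = "the parts outside ⋃_i Y_i meet")
it holds with `c` = the cost of joining two trees inside the outside cube where two incompatible polymers meet (print, p. 388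
(after (1.93)): *"α^{1/3} ≤ exp(−(1+β)κ2d), to produce the exponential factors connecting graphs in domains Y, in the cases they
intersect outside Z′"* — junction cost 2d); it is FALSE for families glued only through a fixed Y_i, which are not clusters.
A HYPOTHESIS of this module (its absolute analogue is unit b13's certified (2.27), `B13FamilySum.Ineq227`).
[cite: Balaban1989LargeFieldII, (1.93) p.388] -/
def RelSubadd (Λ : Finset Dom) (cubes : Dom → Finset Cube) (d : Dom → ℝ) (X : Finset Cube) (dX c : ℝ) : Prop :=
  ∀ C ∈ coveringFamilies Λ cubes X, IsPolymerCluster ι C → dX + c ≤ ∑ Z ∈ C, (d Z + c)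

/-! ## Part B. The Kotecký–Preiss condition with the OUTSIDE footprint, and (1.98) -/

/-- **[KP86] hypothesis (1) for the polymer gas (1.90), relative form.**  Incompatibility footprint-local INTO the outside
footprint (`ι Z′ Z` for a polymer Z′ ∈ Λ ⇒ Z′ owns an outside cube of `reach Z`, `#reach Z ≤ ν·#out Z`), activities supported in the
sub-catalogue `Λ` with |F(Z)| ≤ A e^{−R d(Z)} (the shape of (1.97)), the relative anchored bound (1.26)_rel over `Λ` at rate κ₀
with constant K₀ (`Ineq126 Λ out d κ₀ K₀`), the relative volume bound #out Z ≤ c₁(1 + d(Z)) over `Λ`, the rate condition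
κ₀ + s + τc₁ ≤ R and the smallness A e^{b+τc₁} K₀ ν ≤ τ give, with a(Z) = τ·#out Z and d ↦ s·d + b:
Σ_{Z′ ι Z} |F(Z′)| e^{a(Z′) + s d(Z′) + b} ≤ a(Z) for EVERY Z (p. 390: *"The estimate (1.97) is sufficient for convergence of
the exponentiated cluster expansion"*).  Proof = `B13Resummation.kp_condition` with `cubes ↦ out` and the catalogue `Λ`.
[cite: Balaban1989LargeFieldII, p.390 (before (1.98))] -/
theorem kp_condition_rel [Fintype Dom] {Λ : Finset Dom} {out reach : Dom → Finset Cube} {d : Dom → ℝ}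
    {w : Dom → ℂ} {A R κ₀ K₀ c₁ τ s b ν : ℝ}
    (hloc : ∀ Z, ∀ Z' ∈ Λ, ι Z' Z → ∃ q ∈ reach Z, q ∈ out Z')
    (hreach : ∀ Z, ((reach Z).card : ℝ) ≤ ν * (out Z).card)
    (hd : ∀ Z, 0 ≤ d Z) (hA : 0 ≤ A) (hK₀ : 0 ≤ K₀) (hτ : 0 ≤ τ)
    (hwΛ : ∀ Z, Z ∉ Λ → w Z = 0) (hw : ∀ Z, ‖w Z‖ ≤ A * Real.exp (-(R * d Z)))
    (h126 : Ineq126 Λ out d κ₀ K₀) (hvol : VolBound Λ out d c₁)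
    (hrate : κ₀ + s + τ * c₁ ≤ R) (hsmall : A * Real.exp (b + τ * c₁) * K₀ * ν ≤ τ) (Z : Dom) :
    ∑ Z' ∈ Finset.univ with ι Z' Z,
        ‖w Z'‖ * Real.exp (τ * ((out Z').card : ℝ) + (s * d Z' + b)) ≤ τ * ((out Z).card : ℝ) := by
  set f : Dom → ℝ := fun Z' => ‖w Z'‖ * Real.exp (τ * ((out Z').card : ℝ) + (s * d Z' + b)) with hf
  have hf0 : ∀ Z', 0 ≤ f Z' := fun Z' => mul_nonneg (norm_nonneg _) (Real.exp_nonneg _)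
  have hfΛ : ∀ Z', Z' ∉ Λ → f Z' = 0 := fun Z' hZ' => by
    simp only [hf, hwΛ Z' hZ', norm_zero, zero_mul]
  -- restrict the sum to the catalogue `Λ`
  have hrestr : ∑ Z' ∈ Finset.univ with ι Z' Z, f Z' = ∑ Z' ∈ Λ with ι Z' Z, f Z' := by
    refine (Finset.sum_subset (Finset.filter_subset_filter _ (Finset.subset_univ Λ)) fun Z' hZ' hZ'Λ => ?_).symm
    refine hfΛ Z' fun hmem => hZ'Λ ?_
    exact Finset.mem_filter.2 ⟨hmem, (Finset.mem_filter.1 hZ').2⟩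
  rw [hrestr]
  -- footprint locality: every `Z' ι Z` owns an outside cube of `reach Z`
  have hcover : (Λ.filter fun Z' => ι Z' Z) ⊆
      (reach Z).biUnion fun q => Λ.filter fun Z' => q ∈ out Z' := by
    intro Z' hZ'
    obtain ⟨q, hq, hqZ'⟩ := hloc Z Z' (Finset.mem_filter.1 hZ').1 (Finset.mem_filter.1 hZ').2
    exact Finset.mem_biUnion.2 ⟨q, hq, Finset.mem_filter.2 ⟨(Finset.mem_filter.1 hZ').1, hqZ'⟩⟩
  -- the pointwise bound `f Z' ≤ A e^{b + τ c₁} e^{-κ₀ d(Z')}` on `Λ`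
  have hpt : ∀ Z' ∈ Λ, f Z' ≤ A * Real.exp (b + τ * c₁) * Real.exp (-(κ₀ * d Z')) := by
    intro Z' hZ'Λ
    have hv : τ * ((out Z').card : ℝ) ≤ τ * (c₁ * (1 + d Z')) :=
      mul_le_mul_of_nonneg_left (hvol Z' hZ'Λ) hτ
    have hexp : -(R * d Z') + (τ * (c₁ * (1 + d Z')) + (s * d Z' + b)) =
        (b + τ * c₁) + -((R - τ * c₁ - s) * d Z') := by ring
    calc f Z' ≤ A * Real.exp (-(R * d Z')) * Real.exp (τ * (c₁ * (1 + d Z')) + (s * d Z' + b)) :=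
          mul_le_mul (hw Z') (Real.exp_le_exp.2 (by linarith)) (Real.exp_nonneg _)
            (mul_nonneg hA (Real.exp_nonneg _))
      _ = A * Real.exp (b + τ * c₁) * Real.exp (-((R - τ * c₁ - s) * d Z')) := by
          rw [mul_assoc, ← Real.exp_add, hexp, Real.exp_add, ← mul_assoc]
      _ ≤ A * Real.exp (b + τ * c₁) * Real.exp (-(κ₀ * d Z')) := by
          refine mul_le_mul_of_nonneg_left (Real.exp_le_exp.2 (neg_le_neg ?_))
            (mul_nonneg hA (Real.exp_nonneg _))
          exact mul_le_mul_of_nonneg_right (by linarith) (hd Z')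
  -- (1.26)_rel per anchoring outside cube, then the count of anchoring cubes
  have hq : ∀ q, ∑ Z' ∈ Λ.filter (fun Z' => q ∈ out Z'), f Z' ≤ A * Real.exp (b + τ * c₁) * K₀ := fun q =>
    calc ∑ Z' ∈ Λ.filter (fun Z' => q ∈ out Z'), f Z'
        ≤ ∑ Z' ∈ Λ.filter (fun Z' => q ∈ out Z'),
            A * Real.exp (b + τ * c₁) * Real.exp (-(κ₀ * d Z')) :=
          Finset.sum_le_sum fun Z' hZ' => hpt Z' (Finset.mem_filter.1 hZ').1
      _ = A * Real.exp (b + τ * c₁) *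
            ∑ Z' ∈ Λ.filter (fun Z' => q ∈ out Z'), Real.exp (-(κ₀ * d Z')) := by rw [Finset.mul_sum]
      _ ≤ A * Real.exp (b + τ * c₁) * K₀ :=
          mul_le_mul_of_nonneg_left (h126 q) (mul_nonneg hA (Real.exp_nonneg _))
  calc ∑ Z' ∈ Λ with ι Z' Z, f Z'
      ≤ ∑ Z' ∈ (reach Z).biUnion (fun q => Λ.filter fun Z' => q ∈ out Z'), f Z' :=
        Finset.sum_le_sum_of_subset_of_nonneg hcover fun Z' _ _ => hf0 Z'
    _ ≤ ∑ q ∈ reach Z, ∑ Z' ∈ Λ.filter (fun Z' => q ∈ out Z'), f Z' :=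
        sum_biUnion_le_sum_of_nonneg _ _ f hf0
    _ ≤ ∑ q ∈ reach Z, A * Real.exp (b + τ * c₁) * K₀ := Finset.sum_le_sum fun q _ => hq q
    _ = ((reach Z).card : ℝ) * (A * Real.exp (b + τ * c₁) * K₀) := by
        rw [Finset.sum_const, nsmul_eq_mul]
    _ ≤ ν * ((out Z).card : ℝ) * (A * Real.exp (b + τ * c₁) * K₀) :=
        mul_le_mul_of_nonneg_right (hreach Z)
          (mul_nonneg (mul_nonneg hA (Real.exp_nonneg _)) hK₀)
    _ = (A * Real.exp (b + τ * c₁) * K₀ * ν) * ((out Z).card : ℝ) := by ring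
    _ ≤ τ * ((out Z).card : ℝ) := mul_le_mul_of_nonneg_right hsmall (Nat.cast_nonneg _)

/-- **(1.98)** p. 390 [36], verbatim: *"The estimate (1.97) is sufficient for convergence of the exponentiated cluster
expansion, and we have {⋯} = exp 𝐑′^{(k)} = exp Σ_X 𝐑′^{(k)}(X). (1.98)"* — PROVED for the polymer gas (1.90) on the
catalogue `Λ` ({⋯} = its partition function `polymerPartitionFunction ι F Λ`): under the hypotheses of `kp_condition_rel`
(activities supported in `Λ`), exp(Σ_X 𝐑′^{(k)}(X)) = {⋯} ([KP86] Theorem: zero-freeness and the logarithm property, tree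
`exp_polymerLogZ_of_kp`; localization by the FULL footprints, `logZ_eq_sum_locR`). [cite: Balaban1989LargeFieldII, (1.98) p.390] -/
theorem exp_sum_locR_eq_Z [Fintype Dom] [Std.Refl ι] [Std.Symm ι] {Λ : Finset Dom}
    {cubes out reach : Dom → Finset Cube} {d : Dom → ℝ} {w : Dom → ℂ} {A R κ₀ K₀ c₁ τ ν : ℝ}
    (hloc : ∀ Z, ∀ Z' ∈ Λ, ι Z' Z → ∃ q ∈ reach Z, q ∈ out Z')
    (hreach : ∀ Z, ((reach Z).card : ℝ) ≤ ν * (out Z).card)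
    (hd : ∀ Z, 0 ≤ d Z) (hA : 0 ≤ A) (hK₀ : 0 ≤ K₀) (hτ : 0 ≤ τ)
    (hwΛ : ∀ Z, Z ∉ Λ → w Z = 0) (hw : ∀ Z, ‖w Z‖ ≤ A * Real.exp (-(R * d Z)))
    (h126 : Ineq126 Λ out d κ₀ K₀) (hvol : VolBound Λ out d c₁)
    (hrate : κ₀ + τ * c₁ ≤ R) (hsmall : A * Real.exp (τ * c₁) * K₀ * ν ≤ τ) :
    Complex.exp (∑ X ∈ Λ.powerset.image (fun C => C.biUnion cubes), locR ι Λ cubes w X) =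
      polymerPartitionFunction ι w Λ := by
  have hkp := kp_condition_rel ι hloc hreach hd hA hK₀ hτ hwΛ hw h126 hvol (s := 0) (b := 0)
    (by simpa using hrate) (by simpa using hsmall)
  have h1 := fun γ => kp_hypothesis_of_fintype (inc := ι) (w := w)
    (a := fun Z => τ * ((out Z).card : ℝ)) (d := fun Z => 0 * d Z + 0) hkp γ
  have hdK : ∀ Z, (0 : ℝ) ≤ 0 * d Z + 0 := fun Z => by simp
  have hKP : IsKPVolume ι w (fun Z => τ * ((out Z).card : ℝ)) (Finset.univ : Finset Dom) :=
    isKPVolume_of_tsum_le (inc := ι) (w := w) (a := fun Z => τ * ((out Z).card : ℝ))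
      (d := fun Z => 0 * d Z + 0) hdK h1 Finset.univ
  have h := exp_polymerLogZ_of_kp hKP (Finset.subset_univ Λ)
  rwa [logZ_eq_sum_locR ι Λ cubes w] at h

/-! ## Part C. The anchored cluster bound with two footprints: (1.97) + the relative leaves ⇒ the decay of 𝐑′^{(k)}(X) -/

/-- **(1.99), general form.**  Let `X` be a union of full footprints owning a cube `q₀` which is an OUTSIDE cube of every
polymer of `Λ` containing it (a cube of X∖⋃_i Y_i), with the relative subadditivity `RelSubadd` (constant `c`) for the
ι-clusters covering `X` and a per-member cost `b ≥ r₁c`.  Activities bounded by A e^{−R d(Z)} on the polymers Z ∈ Λ with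
footprint inside `X`, (1.26)_rel (κ₀, K₀) and the relative volume bound (c₁) over `Λ`, footprint-local incompatibility
(reach, ν), the rate condition r₁ + 2κ₀ + 1 + τc₁ ≤ R and the smallness A e^{b+τc₁} K₀ ν ≤ τ give
**|𝐑′^{(k)}(X)| ≤ τ c₁ K₀ e^{−b} e^{−r₁ d(X)}**.  Route = `B13Resummation.norm_locE_le` ([II] p. 21: *"extract the exponential
… from the i-th factor, and the remaining product is estimated using (2.27), and the condition ∪Z_i = X"*) with the
notational change: the anchor and the Kotecký–Preiss size live on the outside footprint, the union on the full one, and the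
non-cluster covering families are discarded first ([KP86] Theorem, last assertion: Φ^T vanishes off clusters).
[cite: Balaban1989LargeFieldII, (1.99) p.390] -/
theorem norm_locR_le [Fintype Dom] [Std.Refl ι] [Std.Symm ι] {Λ : Finset Dom} {cubes out reach : Dom → Finset Cube}
    {d : Dom → ℝ} {w : Dom → ℂ} {A R r₁ κ₀ K₀ c₁ c b τ ν dX : ℝ} {X : Finset Cube} {q₀ : Cube}
    (hloc : ∀ Z, ∀ Z' ∈ Λ, ι Z' Z → ∃ q ∈ reach Z, q ∈ out Z')
    (hreach : ∀ Z, ((reach Z).card : ℝ) ≤ ν * (out Z).card)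
    (hd : ∀ Z, 0 ≤ d Z) (hA : 0 ≤ A) (hK₀ : 0 ≤ K₀) (hc₁ : 0 ≤ c₁) (hτ : 0 ≤ τ) (hκ₀ : 0 ≤ κ₀)
    (hr₁ : 0 ≤ r₁) (hc : 0 ≤ c) (hb : r₁ * c ≤ b)
    (hw : ∀ Z ∈ Λ, cubes Z ⊆ X → ‖w Z‖ ≤ A * Real.exp (-(R * d Z)))
    (h126 : Ineq126 Λ out d κ₀ K₀) (hvol : VolBound Λ out d c₁)
    (hsub : RelSubadd ι Λ cubes d X dX c)
    (hrate : r₁ + 2 * κ₀ + 1 + τ * c₁ ≤ R) (hsmall : A * Real.exp (b + τ * c₁) * K₀ * ν ≤ τ)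
    (hq₀X : q₀ ∈ X) (hq₀ : ∀ Z ∈ Λ, q₀ ∈ cubes Z → q₀ ∈ out Z) :
    ‖locR ι Λ cubes w X‖ ≤ τ * c₁ * K₀ * Real.exp (-b) * Real.exp (-(r₁ * dX)) := by
  classical
  -- pass to the activities truncated to the polymers of `Λ` inside `X`
  set w' : Dom → ℂ := fun Z => if Z ∈ Λ ∧ cubes Z ⊆ X then w Z else 0 with hw'_def
  have hw' : ∀ Z, ‖w' Z‖ ≤ A * Real.exp (-(R * d Z)) := by
    intro Z
    by_cases h : Z ∈ Λ ∧ cubes Z ⊆ X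
    · simp only [hw'_def, h, and_self, if_true]
      exact hw Z h.1 h.2
    · simp only [hw'_def, h, if_false, norm_zero]
      exact mul_nonneg hA (Real.exp_nonneg _)
  have hw'Λ : ∀ Z, Z ∉ Λ → w' Z = 0 := fun Z hZ => by
    simp only [hw'_def, hZ, false_and, if_false]
  rw [locR_congr ι (w := w) (w' := w') (fun Z hZΛ hZ => by simp only [hw'_def, hZΛ, hZ, and_self, if_true])]
  -- Kotecký–Preiss data: `a(Z) = τ #out Z`, `d(Z) = (r₁ + (κ₀ + 1)) d(Z) + b`
  have hb0 : 0 ≤ b := le_trans (mul_nonneg hr₁ hc) hb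
  have ha : ∀ Z, 0 ≤ τ * ((out Z).card : ℝ) := fun Z => mul_nonneg hτ (Nat.cast_nonneg _)
  have hdK : ∀ Z, 0 ≤ (r₁ + (κ₀ + 1)) * d Z + b := fun Z =>
    add_nonneg (mul_nonneg (by linarith) (hd Z)) hb0
  have hkp := kp_condition_rel ι hloc hreach hd hA hK₀ hτ hw'Λ hw' h126 hvol (s := r₁ + (κ₀ + 1)) (b := b)
    (by linarith) hsmall
  have h1 := fun γ => kp_hypothesis_of_fintype (inc := ι) (w := w')
    (a := fun Z => τ * ((out Z).card : ℝ)) (d := fun Z => (r₁ + (κ₀ + 1)) * d Z + b) hkp γ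
  have hfact := koteckyPreiss_truncatedWeight_bound_holds ι w'
    (fun Z => τ * ((out Z).card : ℝ)) (fun Z => (r₁ + (κ₀ + 1)) * d Z + b)
  have hKP : IsKPVolume ι w' (fun Z => τ * ((out Z).card : ℝ)) (Finset.univ : Finset Dom) :=
    isKPVolume_of_tsum_le (inc := ι) (w := w') (a := fun Z => τ * ((out Z).card : ℝ))
      (d := fun Z => (r₁ + (κ₀ + 1)) * d Z + b) hdK h1 Finset.univ
  -- the covering families, and the clusters among them
  set 𝒞 : Finset (Finset Dom) := coveringFamilies Λ cubes X with h𝒞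
  set 𝒞cl : Finset (Finset Dom) := 𝒞.filter fun C => IsPolymerCluster ι C with h𝒞cl
  have hcl : ∑ C ∈ 𝒞cl, ‖truncatedWeight ι w' C‖ = ∑ C ∈ 𝒞, ‖truncatedWeight ι w' C‖ := by
    refine Finset.sum_subset (Finset.filter_subset _ 𝒞) fun C hC hCcl => ?_
    have hncl : ¬ IsPolymerCluster ι C := fun h => hCcl (Finset.mem_filter.2 ⟨hC, h⟩)
    rw [truncatedWeight_eq_zero_of_kp hKP (Finset.subset_univ C) hncl, norm_zero]
  -- the anchor: every covering family has a member owning `q₀` as an outside cube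
  have hcover : 𝒞cl ⊆ (Λ.filter fun Z => q₀ ∈ out Z).biUnion (fun Z => 𝒞cl.filter fun C => Z ∈ C) := by
    intro C hC
    have hC𝒞 : C ∈ 𝒞 := (Finset.mem_filter.1 hC).1
    have hCΛ : C ⊆ Λ := (mem_coveringFamilies.1 hC𝒞).1
    have hU : C.biUnion cubes = X := (mem_coveringFamilies.1 hC𝒞).2
    have hq : q₀ ∈ C.biUnion cubes := by rw [hU]; exact hq₀X
    obtain ⟨Z, hZC, hqZ⟩ := Finset.mem_biUnion.1 hq
    exact Finset.mem_biUnion.2 ⟨Z, Finset.mem_filter.2 ⟨hCΛ hZC, hq₀ Z (hCΛ hZC) hqZ⟩,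
      Finset.mem_filter.2 ⟨hC, hZC⟩⟩
  -- KP estimate (4) at each anchoring polymer, with the relative-subadditivity extraction of the union's decay
  have hanchor : ∀ Z, ∑ C ∈ 𝒞cl with Z ∈ C, ‖truncatedWeight ι w' C‖ ≤
      Real.exp (-((r₁ * dX + b) + (κ₀ + 1) * d Z)) * (τ * ((out Z).card : ℝ)) := by
    intro Z
    refine sum_norm_truncatedWeight_le_exp_neg_mul hfact ha hdK h1 𝒞cl Z fun C hC hZC => ?_
    -- goal: `(r₁ dX + b) + (κ₀+1) d Z ≤ Σ_{Z'∈C} ((r₁ + (κ₀+1)) d Z' + b)`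
    have hsubC : dX + c ≤ ∑ Z' ∈ C, (d Z' + c) :=
      hsub C (Finset.mem_filter.1 hC).1 (Finset.mem_filter.1 hC).2
    rw [Finset.sum_add_distrib, Finset.sum_const, nsmul_eq_mul] at hsubC
    rw [Finset.sum_add_distrib, Finset.sum_const, nsmul_eq_mul, ← Finset.mul_sum]
    have hcard : (1 : ℝ) ≤ (C.card : ℝ) := by exact_mod_cast Finset.card_pos.2 ⟨Z, hZC⟩
    have hsingle : d Z ≤ ∑ Z' ∈ C, d Z' := Finset.single_le_sum (fun Z' _ => hd Z') hZC
    have hkey : (r₁ + (κ₀ + 1)) * (∑ Z' ∈ C, d Z') + (C.card : ℝ) * b -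
        ((r₁ * dX + b) + (κ₀ + 1) * d Z) =
        r₁ * ((∑ Z' ∈ C, d Z') + (C.card : ℝ) * c - (dX + c)) + (κ₀ + 1) * ((∑ Z' ∈ C, d Z') - d Z) +
          ((C.card : ℝ) - 1) * (b - r₁ * c) := by ring
    have t₁ : 0 ≤ r₁ * ((∑ Z' ∈ C, d Z') + (C.card : ℝ) * c - (dX + c)) :=
      mul_nonneg hr₁ (sub_nonneg.2 hsubC)
    have t₂ : 0 ≤ (κ₀ + 1) * ((∑ Z' ∈ C, d Z') - d Z) := mul_nonneg (by linarith) (sub_nonneg.2 hsingle)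
    have t₃ : 0 ≤ ((C.card : ℝ) - 1) * (b - r₁ * c) := mul_nonneg (sub_nonneg.2 hcard) (sub_nonneg.2 hb)
    linarith
  -- per anchoring polymer: `e^{-(P + (κ₀+1)d)} τ #out ≤ e^{-P} τ c₁ e^{-κ₀ d}`
  have hper : ∀ Z ∈ Λ, Real.exp (-((r₁ * dX + b) + (κ₀ + 1) * d Z)) * (τ * ((out Z).card : ℝ)) ≤
      Real.exp (-(r₁ * dX + b)) * (τ * c₁) * Real.exp (-(κ₀ * d Z)) := by
    intro Z hZΛ
    have hv : τ * ((out Z).card : ℝ) ≤ τ * c₁ * Real.exp (d Z) := by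
      have h1' : ((out Z).card : ℝ) ≤ c₁ * (1 + d Z) := hvol Z hZΛ
      have h2' : c₁ * (1 + d Z) ≤ c₁ * Real.exp (d Z) :=
        mul_le_mul_of_nonneg_left (by linarith [Real.add_one_le_exp (d Z)]) hc₁
      calc τ * ((out Z).card : ℝ) ≤ τ * (c₁ * Real.exp (d Z)) :=
            mul_le_mul_of_nonneg_left (h1'.trans h2') hτ
        _ = τ * c₁ * Real.exp (d Z) := by ring
    have hsplit : Real.exp (-((r₁ * dX + b) + (κ₀ + 1) * d Z)) * Real.exp (d Z) =
        Real.exp (-(r₁ * dX + b)) * Real.exp (-(κ₀ * d Z)) := by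
      rw [← Real.exp_add, ← Real.exp_add]
      congr 1
      ring
    calc Real.exp (-((r₁ * dX + b) + (κ₀ + 1) * d Z)) * (τ * ((out Z).card : ℝ))
        ≤ Real.exp (-((r₁ * dX + b) + (κ₀ + 1) * d Z)) * (τ * c₁ * Real.exp (d Z)) :=
          mul_le_mul_of_nonneg_left hv (Real.exp_nonneg _)
      _ = Real.exp (-((r₁ * dX + b) + (κ₀ + 1) * d Z)) * Real.exp (d Z) * (τ * c₁) := by ring
      _ = Real.exp (-(r₁ * dX + b)) * (τ * c₁) * Real.exp (-(κ₀ * d Z)) := by rw [hsplit]; ring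
  -- assembly
  calc ‖locR ι Λ cubes w' X‖ = ‖∑ C ∈ 𝒞, truncatedWeight ι w' C‖ := rfl
    _ ≤ ∑ C ∈ 𝒞, ‖truncatedWeight ι w' C‖ := norm_sum_le _ _
    _ = ∑ C ∈ 𝒞cl, ‖truncatedWeight ι w' C‖ := hcl.symm
    _ ≤ ∑ C ∈ (Λ.filter fun Z => q₀ ∈ out Z).biUnion (fun Z => 𝒞cl.filter fun C => Z ∈ C),
          ‖truncatedWeight ι w' C‖ :=
        Finset.sum_le_sum_of_subset_of_nonneg hcover fun C _ _ => norm_nonneg _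
    _ ≤ ∑ Z ∈ Λ.filter (fun Z => q₀ ∈ out Z), ∑ C ∈ 𝒞cl.filter (fun C => Z ∈ C),
          ‖truncatedWeight ι w' C‖ :=
        sum_biUnion_le_sum_of_nonneg _ _ _ fun C => norm_nonneg _
    _ ≤ ∑ Z ∈ Λ.filter (fun Z => q₀ ∈ out Z),
          Real.exp (-((r₁ * dX + b) + (κ₀ + 1) * d Z)) * (τ * ((out Z).card : ℝ)) :=
        Finset.sum_le_sum fun Z _ => hanchor Z
    _ ≤ ∑ Z ∈ Λ.filter (fun Z => q₀ ∈ out Z),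
          Real.exp (-(r₁ * dX + b)) * (τ * c₁) * Real.exp (-(κ₀ * d Z)) :=
        Finset.sum_le_sum fun Z hZ => hper Z (Finset.mem_filter.1 hZ).1
    _ = Real.exp (-(r₁ * dX + b)) * (τ * c₁) *
          ∑ Z ∈ Λ.filter (fun Z => q₀ ∈ out Z), Real.exp (-(κ₀ * d Z)) := by
        rw [Finset.mul_sum]
    _ ≤ Real.exp (-(r₁ * dX + b)) * (τ * c₁) * K₀ :=
        mul_le_mul_of_nonneg_left (h126 q₀) (mul_nonneg (Real.exp_nonneg _) (mul_nonneg hτ hc₁))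
    _ = τ * c₁ * K₀ * Real.exp (-b) * Real.exp (-(r₁ * dX)) := by
        rw [neg_add, Real.exp_add]; ring

/-! ## Part D. The (1.99) shape: "κ sufficiently large", "c₁ sufficiently small" made explicit -/

/-- **(1.99), kernel form.**  With τ = A e^{b+1} K₀ ν in `norm_locR_le`: if **A e^{b+1} K₀ ν c₁ ≤ 1** (the activity constant
c₁ of (1.97) — e^{−p₀(g_k)} or α^{1/3} — small against the merging cost e^{b}, b = r₁c) and **r₁ + 2κ₀ + 2 ≤ R** (the printed
loss of rate (1+β)κ → (1+½β)κ: ½βκ ≥ 2κ₀ + 2), then **|𝐑′^{(k)}(X)| ≤ (e ν c₁ K₀²) · A · e^{−r₁ d(X)}** — (1.99) with its O(1)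
exhibited. [cite: Balaban1989LargeFieldII, (1.99) p.390] -/
theorem norm_locR_le_of_small [Fintype Dom] [Std.Refl ι] [Std.Symm ι] {Λ : Finset Dom}
    {cubes out reach : Dom → Finset Cube} {d : Dom → ℝ} {w : Dom → ℂ} {A R r₁ κ₀ K₀ c₁ c b ν dX : ℝ}
    {X : Finset Cube} {q₀ : Cube}
    (hloc : ∀ Z, ∀ Z' ∈ Λ, ι Z' Z → ∃ q ∈ reach Z, q ∈ out Z')
    (hreach : ∀ Z, ((reach Z).card : ℝ) ≤ ν * (out Z).card)
    (hd : ∀ Z, 0 ≤ d Z) (hA : 0 ≤ A) (hK₀ : 0 ≤ K₀) (hc₁ : 0 ≤ c₁) (hν : 0 ≤ ν) (hκ₀ : 0 ≤ κ₀)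
    (hr₁ : 0 ≤ r₁) (hc : 0 ≤ c) (hb : r₁ * c ≤ b)
    (hw : ∀ Z ∈ Λ, cubes Z ⊆ X → ‖w Z‖ ≤ A * Real.exp (-(R * d Z)))
    (h126 : Ineq126 Λ out d κ₀ K₀) (hvol : VolBound Λ out d c₁)
    (hsub : RelSubadd ι Λ cubes d X dX c)
    (hrate : r₁ + 2 * κ₀ + 2 ≤ R) (hsmall : A * Real.exp (b + 1) * K₀ * ν * c₁ ≤ 1)
    (hq₀X : q₀ ∈ X) (hq₀ : ∀ Z ∈ Λ, q₀ ∈ cubes Z → q₀ ∈ out Z) :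
    ‖locR ι Λ cubes w X‖ ≤ Real.exp 1 * ν * c₁ * K₀ ^ 2 * A * Real.exp (-(r₁ * dX)) := by
  set τ : ℝ := A * Real.exp (b + 1) * K₀ * ν with hτ_def
  have hτ : 0 ≤ τ := mul_nonneg (mul_nonneg (mul_nonneg hA (Real.exp_nonneg _)) hK₀) hν
  have hτc : τ * c₁ ≤ 1 := hsmall
  have hsmall' : A * Real.exp (b + τ * c₁) * K₀ * ν ≤ τ := by
    have hexp : Real.exp (b + τ * c₁) ≤ Real.exp (b + 1) := Real.exp_le_exp.2 (by linarith)
    calc A * Real.exp (b + τ * c₁) * K₀ * ν ≤ A * Real.exp (b + 1) * K₀ * ν := by gcongr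
      _ = τ := rfl
  have h := norm_locR_le ι hloc hreach hd hA hK₀ hc₁ hτ hκ₀ hr₁ hc hb hw h126 hvol hsub
    (by linarith) hsmall' hq₀X hq₀
  have hcancel : Real.exp (b + 1) * Real.exp (-b) = Real.exp 1 := by
    rw [← Real.exp_add]; congr 1; ring
  calc ‖locR ι Λ cubes w X‖ ≤ τ * c₁ * K₀ * Real.exp (-b) * Real.exp (-(r₁ * dX)) := h
    _ = (Real.exp (b + 1) * Real.exp (-b)) * (ν * c₁ * K₀ ^ 2 * A * Real.exp (-(r₁ * dX))) := by
        rw [hτ_def]; ring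
    _ = Real.exp 1 * ν * c₁ * K₀ ^ 2 * A * Real.exp (-(r₁ * dX)) := by rw [hcancel]; ring

/-! ## Part E. The edge to `B16.lean`: (1.97) ⇒ (1.98), (1.99) over unit b02's `RelDomainSys` -/

/-- **The polymer geometry of (1.90)** over unit b02's `B16.RelDomainSys` (domains of 𝐃_k with the relative size
`dRel` = d_{k,∪Y_i} of (1.67) and the c₁-selector `MeetsLF X` = "X ∩ ⋃_i Y_i ≠ ∅", cell DIVERGENCE D-b02.11): the polymer
sub-catalogue `adm` (p. 388: *"the summation is over {X_{j₁},…,X_{j_q}} and 𝐃 such that the connected localization domain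
they determine is equal to X′"*), the M-cubes of a domain (nonempty), the M-cubes `Yfix` of the FIXED class-2 components
⋃_{i=1}^m Y_i (p. 387), the incompatibility `ι` of the gas (1.90) — reflexive, symmetric, and local INTO the outside parts
X′∖⋃_i Y_i through `reach` with `#reach Z ≤ ν·#(Z∖⋃_i Y_i)` (p. 388 ll. 1–3: components of X′₀∖⋃_i Y_i, glued through
domains Y) — every polymer owning an outside cube (it is built on a nonempty component of X′₀∖⋃_i Y_i), the selector read on
cubes, and the three RELATIVE leaves with their constants: (1.26)_rel at an outside cube (`Ineq126 adm (· ∖ Yfix) dRel κ₀ K₀`;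
[Dimock2013BalabanII] Lemma E.3, unit b01's `B14.RelAnimal.RelCubeSystem.sumsum`, Part F), the relative volume bound
(`c₀`; b01's `RelAnimalLeaf`, Part F) and the cluster subadditivity `RelSubadd` with junction cost `c` (print p. 388: 2d).
A HYPOTHESIS structure like `B13Resummation.Geometry`: the instance is the joiner's (cell TEMPLATE.md §15).
[cite: Balaban1989LargeFieldII, (1.90) p.388] -/
structure Geometry (S : B16.RelDomainSys) (Cube : Type) [DecidableEq Cube] : Type where
  /-- the polymers X′ of (1.90) among the domains of 𝐃_k -/
  adm : Finset S.Dom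
  /-- the M-cubes of a domain -/
  cubes : S.Dom → Finset Cube
  /-- the M-cubes of ⋃_{i=1}^m Y_i -/
  Yfix : Finset Cube
  /-- the cubes through which a polymer can be incompatible with another one -/
  reach : S.Dom → Finset Cube
  /-- the incompatibility of the polymer gas (1.90) -/
  ι : S.Dom → S.Dom → Prop
  /-- `#reach Z ≤ ν · #(Z ∖ ⋃_i Y_i)` -/
  ν : ℝ
  /-- the rate spent on (1.26)_rel -/
  κ₀ : ℝ
  /-- the constant of (1.26)_rel -/
  K₀ : ℝ
  /-- the relative volume constant: `#(Z ∖ ⋃_i Y_i) ≤ c₀ (1 + d_{k,∪Y_i}(Z))` -/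
  c₀ : ℝ
  /-- the junction cost of `RelSubadd` (print: 2d) -/
  c : ℝ
  cubes_nonempty : ∀ X, (cubes X).Nonempty
  ι_refl : ∀ Z, ι Z Z
  ι_symm : ∀ Z Z', ι Z Z' → ι Z' Z
  loc : ∀ Z, ∀ Z' ∈ adm, ι Z' Z → ∃ q ∈ reach Z, q ∈ cubes Z' \ Yfix
  reach_le : ∀ Z, ((reach Z).card : ℝ) ≤ ν * ((cubes Z \ Yfix).card : ℝ)
  out_nonempty : ∀ Z ∈ adm, (cubes Z \ Yfix).Nonempty
  meets_iff : ∀ X, S.MeetsLF X ↔ (cubes X ∩ Yfix).Nonempty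
  ν_nonneg : 0 ≤ ν
  κ₀_nonneg : 0 ≤ κ₀
  K₀_nonneg : 0 ≤ K₀
  c₀_nonneg : 0 ≤ c₀
  c_nonneg : 0 ≤ c
  ineq126 : Ineq126 adm (fun Z => cubes Z \ Yfix) S.dRel κ₀ K₀
  volBound : VolBound adm (fun Z => cubes Z \ Yfix) S.dRel c₀
  relSubadd : ∀ X, @RelSubadd S.Dom Cube (Classical.decEq _) _ ι adm cubes S.dRel (cubes X) (S.dRel X) c

namespace Geometry

variable {S : B16.RelDomainSys} {Cube : Type} [DecidableEq Cube] (G : Geometry S Cube)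

open Classical in
/-- **𝐑′^{(k)}(X, φ)** for the geometry: the `cubes X`-localized part (`locR`, FULL footprints) of log {⋯}(φ) for the
activities Z ↦ F(Z, φ) of (1.91) on the polymer catalogue. [cite: Balaban1989LargeFieldII, (1.98) p.390] -/
def R' {Φ : Type*} (F : S.Dom → Φ → ℂ) (X : S.Dom) (φ : Φ) : ℂ :=
  locR G.ι G.adm G.cubes (fun Z => F Z φ) (G.cubes X)

open Classical in
/-- The anchored bound of Part D in the geometry: if every polymer inside `X` has activity ≤ A e^{−(1+β)κ d_{k,∪Y_i}} at φ,
`X` owns a cube outside ⋃_i Y_i, ½βκ ≥ 2κ₀ + 2 and A e^{(1+½β)κc + 1} K₀ ν c₀ ≤ 1, then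
|𝐑′^{(k)}(X, φ)| ≤ e ν c₀ K₀² · A · e^{−(1+½β)κ d_{k,∪Y_i}(X)}. [cite: Balaban1989LargeFieldII, (1.99) p.390] -/
theorem norm_R'_le {Φ : Type*} (F : S.Dom → Φ → ℂ) {A β κ : ℝ} {X : S.Dom} {φ : Φ} {q₀ : Cube}
    (hA : 0 ≤ A) (hr : 0 ≤ (1 + β / 2) * κ) (hlarge : (1 + β / 2) * κ + 2 * G.κ₀ + 2 ≤ (1 + β) * κ)
    (hsmall : A * Real.exp ((1 + β / 2) * κ * G.c + 1) * G.K₀ * G.ν * G.c₀ ≤ 1)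
    (hw : ∀ Z ∈ G.adm, G.cubes Z ⊆ G.cubes X → ‖F Z φ‖ ≤ A * Real.exp (-((1 + β) * κ) * S.dRel Z))
    (hq₀ : q₀ ∈ G.cubes X) (hq₀Y : q₀ ∉ G.Yfix) :
    ‖G.R' F X φ‖ ≤ Real.exp 1 * G.ν * G.c₀ * G.K₀ ^ 2 * A * Real.exp (-((1 + β / 2) * κ) * S.dRel X) := by
  haveI : Std.Refl G.ι := ⟨G.ι_refl⟩
  haveI : Std.Symm G.ι := ⟨G.ι_symm⟩
  have h := norm_locR_le_of_small G.ι (Λ := G.adm) (cubes := G.cubes) (out := fun Z => G.cubes Z \ G.Yfix)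
    (w := fun Z => F Z φ) (R := (1 + β) * κ) (r₁ := (1 + β / 2) * κ) (b := (1 + β / 2) * κ * G.c) (c := G.c)
    (dX := S.dRel X) (X := G.cubes X) (q₀ := q₀)
    G.loc G.reach_le S.dRel_nonneg hA G.K₀_nonneg G.c₀_nonneg G.ν_nonneg G.κ₀_nonneg hr G.c_nonneg le_rfl
    (fun Z hZ hZX => by simpa only [neg_mul] using hw Z hZ hZX) G.ineq126 G.volBound
    (by convert G.relSubadd X) (by linarith) hsmall hq₀
    (fun Z _ hqZ => Finset.mem_sdiff.2 ⟨hqZ, hq₀Y⟩)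
  simpa only [R', neg_mul] using h

open Classical in
/-- A domain all of whose cubes lie in ⋃_i Y_i carries no covering family of polymers (every polymer owns an outside
cube), so 𝐑′^{(k)}(X) = 0 there (p. 390: *"admissible domains, i.e., domains with nonzero expressions 𝐑′^{(k)}(X), …
contain at least one large field region connected with one of the 𝐓′_k-operations"*). [cite: Balaban1989LargeFieldII, p.390 (after (1.98))] -/
theorem R'_eq_zero_of_subset {Φ : Type*} (F : S.Dom → Φ → ℂ) {X : S.Dom} (hX : G.cubes X ⊆ G.Yfix) (φ : Φ) :
    G.R' F X φ = 0 := by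
  unfold R' locR
  refine Finset.sum_eq_zero fun C hC => ?_
  exfalso
  obtain ⟨hCΛ, hU⟩ := mem_coveringFamilies.1 hC
  obtain ⟨q, hq⟩ := G.cubes_nonempty X
  rw [← hU] at hq
  obtain ⟨Z, hZC, hqZ⟩ := Finset.mem_biUnion.1 hq
  obtain ⟨q', hq'⟩ := G.out_nonempty Z (hCΛ hZC)
  have hZX : G.cubes Z ⊆ G.cubes X := by rw [← hU]; exact Finset.subset_biUnion_of_mem G.cubes hZC
  exact (Finset.mem_sdiff.1 hq').2 (hX (hZX (Finset.mem_sdiff.1 hq').1))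

open Classical in
/-- **(1.97) ⇒ (1.99), PROVED** (cell GAPS G-B16-09 repaired in the kernel).  p. 390 [36]: *"The estimate (1.97) is
sufficient for convergence of the exponentiated cluster expansion … It is given by the convergent series (7.13) [I] (with
proper notational changes), and it satisfies the inequality |𝐑′^{(k)}(X,(𝐔,𝐉))| ≤ O(1)c₁ exp(−(1+½β)κ d_{k,∪Y_i}(X)).
(1.99)"* — from unit b02's quoted leaf `B16.Ineq197` to its `B16.Ineq199` BY NAME, for 𝐑′^{(k)}(X, ·) := `G.R' F X` and
the exhibited O(1) = e ν c₀ K₀², under: the restriction property of the spaces Ũ^c_k(X, α̃₀, α̃₁) (a configuration on X is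
one on every Z ⊂ X; [II] p. 15), the selector smallness e^{−p₀(g_k)} ≤ α^{1/3} (g_k small — needed because a polymer inside a
domain meeting ⋃_i Y_i may itself miss it; cell GAPS G-pv13-3 (c)), "κ sufficiently large" := ½βκ ≥ 2κ₀ + 2, and "α
sufficiently small" := α^{1/3} e^{(1+½β)κc + 1} K₀ ν c₀ ≤ 1 (cell SMALLNESS.md).  Engine: [KP86] Theorem (tree-proved).
[cite: Balaban1989LargeFieldII, (1.97)-(1.99) p.390] -/
theorem ineq199_of_ineq197 {Φ : Type*} (dom : S.Dom → Set Φ) (F : S.Dom → Φ → ℂ) {p0val α β κ : ℝ}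
    (hsp : ∀ X Z φ, G.cubes Z ⊆ G.cubes X → φ ∈ dom X → φ ∈ dom Z)
    (hα : 0 ≤ α) (hr : 0 ≤ (1 + β / 2) * κ) (hpα : Real.exp (-p0val) ≤ α ^ (1 / 3 : ℝ))
    (hlarge : (1 + β / 2) * κ + 2 * G.κ₀ + 2 ≤ (1 + β) * κ)
    (hsmall : α ^ (1 / 3 : ℝ) * Real.exp ((1 + β / 2) * κ * G.c + 1) * G.K₀ * G.ν * G.c₀ ≤ 1)
    (h197 : B16.Ineq197 S dom F p0val α β κ) :
    B16.Ineq199 S dom (G.R' F) (Real.exp 1 * G.ν * G.c₀ * G.K₀ ^ 2) p0val α β κ := by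
  have hα3 : 0 ≤ α ^ (1 / 3 : ℝ) := Real.rpow_nonneg hα _
  have hM : 0 ≤ Real.exp ((1 + β / 2) * κ * G.c + 1) * G.K₀ * G.ν * G.c₀ :=
    mul_nonneg (mul_nonneg (mul_nonneg (Real.exp_nonneg _) G.K₀_nonneg) G.ν_nonneg) G.c₀_nonneg
  have hsmall0 : Real.exp (-p0val) * Real.exp ((1 + β / 2) * κ * G.c + 1) * G.K₀ * G.ν * G.c₀ ≤ 1 :=
    calc Real.exp (-p0val) * Real.exp ((1 + β / 2) * κ * G.c + 1) * G.K₀ * G.ν * G.c₀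
        = Real.exp (-p0val) * (Real.exp ((1 + β / 2) * κ * G.c + 1) * G.K₀ * G.ν * G.c₀) := by ring
      _ ≤ α ^ (1 / 3 : ℝ) * (Real.exp ((1 + β / 2) * κ * G.c + 1) * G.K₀ * G.ν * G.c₀) :=
          mul_le_mul_of_nonneg_right hpα hM
      _ = α ^ (1 / 3 : ℝ) * Real.exp ((1 + β / 2) * κ * G.c + 1) * G.K₀ * G.ν * G.c₀ := by ring
      _ ≤ 1 := hsmall
  -- the activity bound inside a domain, with the weaker constant α^{1/3} everywhere
  have hwα : ∀ X φ, φ ∈ dom X → ∀ Z ∈ G.adm, G.cubes Z ⊆ G.cubes X →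
      ‖F Z φ‖ ≤ α ^ (1 / 3 : ℝ) * Real.exp (-((1 + β) * κ) * S.dRel Z) := by
    intro X φ hφ Z _ hZX
    have hφZ : φ ∈ dom Z := hsp X Z φ hZX hφ
    by_cases hZ : S.MeetsLF Z
    · exact h197.2 Z hZ φ hφZ
    · exact (h197.1 Z hZ φ hφZ).trans (mul_le_mul_of_nonneg_right hpα (Real.exp_nonneg _))
  refine ⟨fun X hX φ hφ => ?_, fun X hX φ hφ => ?_⟩
  · -- X ∩ ⋃_i Y_i = ∅: every polymer inside X misses ⋃_i Y_i, constant e^{−p₀(g_k)}; anchor = any cube of X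
    have hXY : ∀ q ∈ G.cubes X, q ∉ G.Yfix := fun q hq hqY =>
      hX ((G.meets_iff X).2 ⟨q, Finset.mem_inter.2 ⟨hq, hqY⟩⟩)
    obtain ⟨q₀, hq₀⟩ := G.cubes_nonempty X
    refine G.norm_R'_le F (Real.exp_nonneg _) hr hlarge hsmall0 (fun Z hZ hZX => ?_) hq₀ (hXY q₀ hq₀)
    have hZmiss : ¬ S.MeetsLF Z := fun hZm => by
      obtain ⟨q, hq⟩ := (G.meets_iff Z).1 hZm
      exact hXY q (hZX (Finset.mem_inter.1 hq).1) (Finset.mem_inter.1 hq).2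
    exact h197.1 Z hZmiss φ (hsp X Z φ hZX hφ)
  · -- X ∩ ⋃_i Y_i ≠ ∅: constant α^{1/3}; either X ⊂ ⋃_i Y_i (then 𝐑′(X) = 0) or X owns an outside cube
    by_cases hout : (G.cubes X \ G.Yfix).Nonempty
    · obtain ⟨q₀, hq₀⟩ := hout
      exact G.norm_R'_le F hα3 hr hlarge hsmall (hwα X φ hφ) (Finset.mem_sdiff.1 hq₀).1 (Finset.mem_sdiff.1 hq₀).2
    · have hsub : G.cubes X ⊆ G.Yfix := fun q hq => by
        by_contra hqY
        exact hout ⟨q, Finset.mem_sdiff.2 ⟨hq, hqY⟩⟩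
      rw [G.R'_eq_zero_of_subset F hsub φ, norm_zero]
      have hC : 0 ≤ Real.exp 1 * G.ν * G.c₀ * G.K₀ ^ 2 :=
        mul_nonneg (mul_nonneg (mul_nonneg (Real.exp_nonneg _) G.ν_nonneg) G.c₀_nonneg) (sq_nonneg _)
      exact mul_nonneg (mul_nonneg hC hα3) (Real.exp_nonneg _)

open Classical in
/-- **(1.97) ⇒ (1.98), PROVED**: at a configuration φ lying in all the spaces (e.g. the small real background field), with
the activities vanishing off the polymer catalogue, the curly bracket of (1.72) — the partition function of the gas (1.90) —
equals exp Σ_X 𝐑′^{(k)}(X, φ) (the sum over the unions X of footprints of polymer families; [KP86] Theorem: Ξ ≠ 0 on the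
polydisc and log Ξ = Σ Φ^T), under the hypotheses of `ineq199_of_ineq197`. [cite: Balaban1989LargeFieldII, (1.98) p.390] -/
theorem eq198_of_ineq197 {Φ : Type*} (dom : S.Dom → Set Φ) (F : S.Dom → Φ → ℂ) {p0val α β κ : ℝ} {φ : Φ}
    (hφ : ∀ Z, φ ∈ dom Z) (hF : ∀ Z, Z ∉ G.adm → F Z φ = 0)
    (hα : 0 ≤ α) (hr : 0 ≤ (1 + β / 2) * κ) (hpα : Real.exp (-p0val) ≤ α ^ (1 / 3 : ℝ))
    (hlarge : (1 + β / 2) * κ + 2 * G.κ₀ + 2 ≤ (1 + β) * κ)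
    (hsmall : α ^ (1 / 3 : ℝ) * Real.exp ((1 + β / 2) * κ * G.c + 1) * G.K₀ * G.ν * G.c₀ ≤ 1)
    (h197 : B16.Ineq197 S dom F p0val α β κ) :
    Complex.exp (∑ X ∈ G.adm.powerset.image (fun C => C.biUnion G.cubes),
        locR G.ι G.adm G.cubes (fun Z => F Z φ) X) = polymerPartitionFunction G.ι (fun Z => F Z φ) G.adm := by
  haveI : Std.Refl G.ι := ⟨G.ι_refl⟩
  haveI : Std.Symm G.ι := ⟨G.ι_symm⟩
  have hα3 : 0 ≤ α ^ (1 / 3 : ℝ) := Real.rpow_nonneg hα _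
  -- uniform activity bound with constant α^{1/3}
  have hw : ∀ Z, ‖F Z φ‖ ≤ α ^ (1 / 3 : ℝ) * Real.exp (-(((1 + β) * κ) * S.dRel Z)) := by
    intro Z
    rw [← neg_mul]
    by_cases hZ : S.MeetsLF Z
    · exact h197.2 Z hZ φ (hφ Z)
    · exact (h197.1 Z hZ φ (hφ Z)).trans (mul_le_mul_of_nonneg_right hpα (Real.exp_nonneg _))
  -- τ := α^{1/3} e K₀ ν; then τ c₀ ≤ 1 and the smallness of `exp_sum_locR_eq_Z`
  set τ : ℝ := α ^ (1 / 3 : ℝ) * Real.exp 1 * G.K₀ * G.ν with hτ_def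
  have hτ : 0 ≤ τ := mul_nonneg (mul_nonneg (mul_nonneg hα3 (Real.exp_nonneg _)) G.K₀_nonneg) G.ν_nonneg
  have hb : (1 : ℝ) ≤ (1 + β / 2) * κ * G.c + 1 := by nlinarith [G.c_nonneg]
  have hτc : τ * G.c₀ ≤ 1 :=
    calc τ * G.c₀ = α ^ (1 / 3 : ℝ) * Real.exp 1 * G.K₀ * G.ν * G.c₀ := by rw [hτ_def]
      _ ≤ α ^ (1 / 3 : ℝ) * Real.exp ((1 + β / 2) * κ * G.c + 1) * G.K₀ * G.ν * G.c₀ := by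
          gcongr
          · exact G.c₀_nonneg
          · exact G.ν_nonneg
          · exact G.K₀_nonneg
      _ ≤ 1 := hsmall
  have hsmall' : α ^ (1 / 3 : ℝ) * Real.exp (τ * G.c₀) * G.K₀ * G.ν ≤ τ := by
    have hexp : Real.exp (τ * G.c₀) ≤ Real.exp 1 := Real.exp_le_exp.2 hτc
    calc α ^ (1 / 3 : ℝ) * Real.exp (τ * G.c₀) * G.K₀ * G.ν ≤ α ^ (1 / 3 : ℝ) * Real.exp 1 * G.K₀ * G.ν := by
          gcongr
          · exact G.ν_nonneg
          · exact G.K₀_nonneg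
      _ = τ := by rw [hτ_def]
  have hrate : G.κ₀ + τ * G.c₀ ≤ (1 + β) * κ := by linarith [G.κ₀_nonneg]
  exact exp_sum_locR_eq_Z G.ι (cubes := G.cubes) (out := fun Z => G.cubes Z \ G.Yfix) G.loc G.reach_le
    S.dRel_nonneg hα3 G.K₀_nonneg hτ hF hw G.ineq126 G.volBound hrate hsmall'

end Geometry

/-! ### Non-vacuity of the hypothesis structure (one-polymer toy instance) -/

/-- A one-domain relative domain system (d_k = d_{k,∪Y_i} = 0, no large field): the carrier of `toyGeometry`. [folklore] -/
def toyRelDomainSys : B16.RelDomainSys where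
  Dom := Unit
  dj := fun _ => 0
  dj_nonneg := fun _ => le_rfl
  dRel := fun _ => 0
  MeetsLF := fun _ => False
  dRel_nonneg := fun _ => le_rfl
  dRel_le := fun _ => le_rfl
  dRel_eq_of_not_meets := fun _ _ => rfl

/-- **`Geometry` is inhabited** (witness against vacuity of the hypothesis structure): one polymer made of one cube, no fixed
cubes, everything incompatible with everything, ν = K₀ = c₀ = 1, κ₀ = c = 0. [folklore] -/
def toyGeometry : Geometry toyRelDomainSys Unit where
  adm := {()}
  cubes := fun _ => {()}
  Yfix := ∅
  reach := fun _ => {()}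
  ι := fun _ _ => True
  ν := 1
  κ₀ := 0
  K₀ := 1
  c₀ := 1
  c := 0
  cubes_nonempty := fun _ => ⟨(), Finset.mem_singleton_self _⟩
  ι_refl := fun _ => trivial
  ι_symm := fun _ _ _ => trivial
  loc := fun _ Z' _ _ => ⟨(), Finset.mem_singleton_self _, by simp⟩
  reach_le := fun _ => by simp
  out_nonempty := fun _ _ => ⟨(), by simp⟩
  meets_iff := fun _ => by simp [toyRelDomainSys]
  ν_nonneg := zero_le_one
  κ₀_nonneg := le_rfl
  K₀_nonneg := zero_le_one
  c₀_nonneg := zero_le_one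
  c_nonneg := le_rfl
  ineq126 := fun q => by simp [toyRelDomainSys, Finset.card_le_one]
  volBound := fun Y _ => by simp [toyRelDomainSys]
  relSubadd := fun X C _ _ => by simp [toyRelDomainSys]

/-! ## Part F. Shape bridges: the relative leaves from unit b01's `B14.RelAnimal.RelCubeSystem` -/

/-- The (1.26)_rel leaf of `Geometry` in b01's letters: for a `RelCubeSystem` carrier (fixed region `Z`, small-field parts
`small X = cubes X ∖ Z`, admissible class `adm`) with neighbour degree ≤ Δ and the relative animal leaf (constant c₀), at every
rate κ ≥ κ_rel(c₀, Δ): `Ineq126 adm small dRel κ (Krel c₀ Δ)` — b01's kernel theorem `sumsum` ([Dimock2013BalabanII] Lemma E.3)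
at the small-field cubes, and the empty sum at the cubes of `Z`. [cite: Dimock2013BalabanII, App. E Lemma E.3 (arXiv:1212.5562v2 TeX L6914-6920)] -/
theorem ineq126_of_relCubeSystem {S : B16.RelDomainSys} (G : B14.RelAnimal.RelCubeSystem S) {Δ : ℕ}
    (hΔ : G.DegreeLE Δ) {c₀ : ℝ} (hL : G.RelAnimalLeaf c₀) {κ : ℝ} (hκ : B14.RelAnimal.kapparel c₀ Δ ≤ κ) :
    Ineq126 G.adm G.small S.dRel κ (B14.RelAnimal.Krel c₀ Δ) := by
  classical
  intro c
  by_cases hc : c ∈ G.Z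
  · have hempty : G.adm.filter (fun X => c ∈ G.small X) = ∅ :=
      Finset.filter_eq_empty_iff.2 fun X _ h => (G.mem_small.1 h).2 hc
    rw [hempty, Finset.sum_empty]
    exact (B14.RelAnimal.Krel_pos c₀ Δ).le
  · have hset : G.adm.filter (fun X => c ∈ G.small X) = G.adm.filter (fun X => c ∈ G.cubes X) :=
      Finset.filter_congr fun X _ => by
        rw [G.mem_small]
        exact ⟨fun h => h.1, fun h => ⟨h, hc⟩⟩
    rw [hset]
    simpa only [neg_mul] using G.sumsum hΔ hL hκ c hc

/-- The relative volume leaf of `Geometry` in b01's letters: the relative animal leaf (an animal A ⊇ small X with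
#A ≤ c₀(1 + d_{j,Z}(X))) gives `#small X ≤ c₀(1 + dRel X)` on any class of domains (`VolBound`), for c₀ ≥ 0.
[cite: Dimock2013BalabanII, App. E Lemma E.1 (arXiv:1212.5562v2 TeX L6776-6798)] -/
theorem volBound_of_relAnimalLeaf {S : B16.RelDomainSys} (G : B14.RelAnimal.RelCubeSystem S) {c₀ : ℝ}
    (hc₀ : 0 ≤ c₀) (hL : G.RelAnimalLeaf c₀) (T : Finset S.Dom) : VolBound T G.small S.dRel c₀ := by
  intro X _
  by_cases h : (G.small X).Nonempty
  · obtain ⟨A, hSA, -, -, hA⟩ := hL X h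
    exact le_trans (by exact_mod_cast Finset.card_le_card hSA) hA
  · rw [Finset.not_nonempty_iff_eq_empty.1 h, Finset.card_empty, Nat.cast_zero]
    exact mul_nonneg hc₀ (by linarith [S.dRel_nonneg X])

/-! ## Part N. The second exponentiation (p. 391): what the Kotecký–Preiss criterion requires of a clique -/

section Clique

variable {P : Type*} {inc : P → P → Prop} [DecidableRel inc]

/-- **The Kotecký–Preiss condition on a clique forces N·ε ≤ e⁻¹.**  If [KP86] (1) (finite-volume form `IsKPVolume`, ANY size
function a ≥ anything) holds on a volume Λ containing N PAIRWISE INCOMPATIBLE polymers each of activity ≥ ε in modulus, then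
N·ε ≤ e⁻¹: at the clique member s₀ minimising a, a(s₀) ≥ Σ_{t∈K} |w t| e^{a(t)} ≥ Nε e^{a(s₀)}, and x e^{−x} ≤ e⁻¹.  Bearing
(cell GAPS G-B16-11 (ii), G-adv3-4): in the SECOND expansion of p. 391 (*"we use the ordinary notion of connectedness to
define components"*) all polymers containing a fixed Y_i are pairwise incompatible, so the criterion needs (number of such
polymers with |F| ≥ ε)·ε ≤ e⁻¹ — a condition on the NUMBER of terms attached to Y_i which the printed *"there are no
summations over these domains, they are fixed"* does not address (it removes the entropy of Y_i itself, which Part C indeed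
never charges).  Not a statement about the first expansion (1.90), where such polymers are compatible. [cite: KoteckyPreiss1986, (1) p.492] -/
theorem card_mul_le_exp_neg_one_of_isKPVolume {Λ K : Finset P} {w : P → ℂ} {a : P → ℝ} {ε : ℝ}
    (hKP : IsKPVolume inc w a Λ) (hKΛ : K ⊆ Λ) (hK : K.Nonempty)
    (hclique : ∀ s ∈ K, ∀ t ∈ K, inc t s) (hε : ∀ t ∈ K, ε ≤ ‖w t‖) :
    (K.card : ℝ) * ε ≤ Real.exp (-1) := by
  by_cases hε0 : ε ≤ 0
  · exact le_trans (mul_nonpos_of_nonneg_of_nonpos (Nat.cast_nonneg _) hε0) (Real.exp_nonneg _)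
  replace hε0 : 0 < ε := lt_of_not_ge hε0
  obtain ⟨s₀, hs₀, hmin⟩ := Finset.exists_min_image K a hK
  have hsum : (K.card : ℝ) * ε * Real.exp (a s₀) ≤ a s₀ :=
    calc (K.card : ℝ) * ε * Real.exp (a s₀) = ∑ t ∈ K, ε * Real.exp (a s₀) := by
          rw [Finset.sum_const, nsmul_eq_mul]; ring
      _ ≤ ∑ t ∈ K, kpTerm w a t := Finset.sum_le_sum fun t ht =>
          mul_le_mul (hε t ht) (Real.exp_le_exp.2 (hmin t ht)) (Real.exp_nonneg _) (norm_nonneg _)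
      _ ≤ ∑ t ∈ Λ with inc t s₀, kpTerm w a t :=
          Finset.sum_le_sum_of_subset_of_nonneg
            (fun t ht => Finset.mem_filter.2 ⟨hKΛ ht, hclique s₀ hs₀ t ht⟩) fun t _ _ => kpTerm_nonneg w a t
      _ ≤ a s₀ := hKP s₀ (hKΛ hs₀)
  -- `x e^{−x} ≤ e^{−1}` from `1 + (x − 1) ≤ e^{x−1}`
  have hxe : a s₀ * Real.exp (-a s₀) ≤ Real.exp (-1) := by
    have h : a s₀ ≤ Real.exp (a s₀ - 1) := by linarith [Real.add_one_le_exp (a s₀ - 1)]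
    calc a s₀ * Real.exp (-a s₀) ≤ Real.exp (a s₀ - 1) * Real.exp (-a s₀) :=
          mul_le_mul_of_nonneg_right h (Real.exp_nonneg _)
      _ = Real.exp (-1) := by rw [← Real.exp_add]; ring_nf
  calc (K.card : ℝ) * ε = (K.card : ℝ) * ε * Real.exp (a s₀) * Real.exp (-a s₀) := by
        rw [mul_assoc ((K.card : ℝ) * ε), ← Real.exp_add, add_neg_cancel, Real.exp_zero, mul_one]
    _ ≤ a s₀ * Real.exp (-a s₀) := mul_le_mul_of_nonneg_right hsum (Real.exp_nonneg _)
    _ ≤ Real.exp (-1) := hxe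

/-- **The partition function of a clique** (pairwise incompatible polymers; symmetric incompatibility): only the empty
family and the singletons are compatible, so Ξ_K = 1 + Σ_{t∈K} w(t) (tree `polymerPartitionFunction_insert`). [folklore] -/
theorem polymerPartitionFunction_clique [DecidableEq P] (hsymm : ∀ γ γ', inc γ γ' → inc γ' γ) (w : P → ℂ)
    {K : Finset P}
    (hclique : ∀ s ∈ K, ∀ t ∈ K, s ≠ t → inc s t) :
    polymerPartitionFunction inc w K = 1 + ∑ t ∈ K, w t := by
  induction K using Finset.induction_on with
  | empty => simp
  | @insert γ Λ hγ ih =>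
    have hΛ : ∀ s ∈ Λ, ∀ t ∈ Λ, s ≠ t → inc s t := fun s hs t ht hst =>
      hclique s (Finset.mem_insert_of_mem hs) t (Finset.mem_insert_of_mem ht) hst
    have hfilter : Λ.filter (fun γ' => ¬ inc γ γ') = ∅ :=
      Finset.filter_eq_empty_iff.2 fun t ht h =>
        h (hclique γ (Finset.mem_insert_self γ Λ) t (Finset.mem_insert_of_mem ht) (fun hγt => hγ (hγt ▸ ht)))
    rw [polymerPartitionFunction_insert hsymm w hγ, hfilter, polymerPartitionFunction_empty, ih hΛ,
      Finset.sum_insert hγ]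
    ring

/-- **The clique partition function vanishes for an admissible activity pattern.**  N ≥ 1 pairwise incompatible polymers
with the equal activities w ≡ −1/N (modulus 1/N — within ANY uniform activity bound ε once N ≥ 1/ε) have Ξ_K = 1 + N·(−1/N)
= 0.  Bearing (cell GAPS G-B16-11 (ii)): activity bounds of the printed type for the second expansion (uniform in the number
N of boundary-term domains through a fixed Y_i, no decay factor in |Y_i|) do not by themselves give a zero-free square
bracket in (1.103), hence no logarithm (1.104). [folklore] -/
theorem polymerPartitionFunction_clique_eq_zero [DecidableEq P] (hsymm : ∀ γ γ', inc γ γ' → inc γ' γ) {K : Finset P}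
    (hK : K.Nonempty) (hclique : ∀ s ∈ K, ∀ t ∈ K, s ≠ t → inc s t) :
    polymerPartitionFunction inc (fun _ => -(1 / (K.card : ℂ))) K = 0 := by
  rw [polymerPartitionFunction_clique hsymm _ hclique, Finset.sum_const, nsmul_eq_mul]
  have hN : (K.card : ℂ) ≠ 0 := Nat.cast_ne_zero.2 (Finset.card_pos.2 hK).ne'
  field_simp
  ring

/-- Consequently no number L has e^L = Ξ_K for that pattern: the exponential form "[⋯] = exp Σ_X 𝐁′^{(k)}(X)" of (1.104)
cannot be inferred from activity bounds admitting it. [folklore] -/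
theorem not_exists_exp_eq_clique [DecidableEq P] (hsymm : ∀ γ γ', inc γ γ' → inc γ' γ) {K : Finset P} (hK : K.Nonempty)
    (hclique : ∀ s ∈ K, ∀ t ∈ K, s ≠ t → inc s t) :
    ¬ ∃ L : ℂ, Complex.exp L = polymerPartitionFunction inc (fun _ => -(1 / (K.card : ℂ))) K := by
  rintro ⟨L, hL⟩
  rw [polymerPartitionFunction_clique_eq_zero hsymm hK hclique] at hL
  exact Complex.exp_ne_zero L hL

end Clique

end Literature.MathematicalPhysics.QuantumFieldTheory.Balaban1983to89.B16Exp198
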